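import Mathlib
import Summits.NavierStokesRegularity.NavierStokesRegularity.Theorems.WakeRatchetTailRatchetRelayBordered
import Summits.NavierStokesRegularity.NavierStokesRegularity.Theorems.WakeRatchetTailRatchetRelayDrainDirection
import HarnessLib

/-!
# `WakeRatchet.TailRatchet` (stmt-NavierStokesRegularity-21808): the bordered linearised drain-free front
# problem with an ARBITRARY bordering direction `g` (`∫w₁g ≠ 0`), and the DRAIN-bordered case `g = 8e^{3t}`

Support file for the crux `TailRatchet` (route `WakeRatchet`; MODEL lattice ODEs of Tao 2016 §1.2, §4 —
nothing in this file is a statement about the Navier–Stokes equations, and no item is closed here).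

Context (`…RelayBordered`, `…RelayDrainDirection`; census of stmt-21808, programme "R-lac"): the bordered
problem `L₀h + σg = f` (`L₀h = h' − 2e^{t/2}h(t/2)`, `h(0) = 0`, `h(−∞) = 0`) was solved in
`…RelayBordered` for the time-ratio direction `g = ∂_sG = (1+t/2)e^{t}`.  The nonlinear step of the
programme is best run at FIXED time ratio `s` with the drain parameter `δ` as the bordering unknown (this
avoids the derivative loss of `s ↦ b(t/s)`; the frozen-dilation error `L_s − L_2` is `O(|s−2|)` from
`X_γ` to `Y_γ` thanks to the coefficient `e^{t/2}`), i.e. with the bordering direction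
`g = ∂_δG(b₀,2) = 8e^{3t}`, whose pairing with the adjoint mode is `ℓ_δ ≠ 0`
(`WakeRatchetRelayDrainDirection.drain_functional_integral_neg`).  This file records, sorry-free:

* `bordered_exists_general`, `bordered_unique_general` — existence (`σ = ∫w₁f / ∫w₁g`) and uniqueness for
  ANY bordering direction `g` continuous, bounded and integrable on `(−∞,0]` with `∫w₁g ≠ 0`;
* `drain_bordered_exists`, `drain_bordered_unique` — the case `g = 8e^{3t}`.

HONEST FRAMING: elementary real analysis; MODEL lattice only; the construction item and the crux stay open;
lacunary fronts do NOT refute `TailRatchet` (which needs `Λ → 1`).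
-/

noncomputable section

set_option linter.dupNamespace false

namespace Summit.NavierStokesRegularity.NavierStokesRegularity.Theorems

namespace WakeRatchetRelayBorderedGeneral

open MeasureTheory Set Filter Topology Real intervalIntegral
open WakeRatchetRelayKernel WakeRatchetRelayTransversality WakeRatchetRelayGreen
  WakeRatchetRelaySolvability WakeRatchetRelaySolvabilityLimit WakeRatchetRelayBordered
  WakeRatchetRelayDrainDirection

variable {f g : ℝ → ℝ} {A Cg : ℝ}

/-! ## General bordering direction -/

/-- **EXISTENCE, general bordering direction.**  Let `f, g` be continuous with `|f| ≤ A`, `|g| ≤ C_g` on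
`(−∞,0]`, both integrable there, and `∫_{(−∞,0]} w₁ g ≠ 0`.  Put `σ := (∫w₁f)/(∫w₁g)`.  Then there is `h`
continuous on `ℝ`, bounded on `(−∞,0]`, `h(0) = 0`, `h → 0` at `−∞`, with `h' = 2e^{t/2}h(t/2) + f − σg`
on `t < 0`.
[cite: Tao2016AveragedNS, §1.2 (dyadic model); cell vocabulary (bordered linearisation at the relay profile; programme R-lac)] -/
theorem bordered_exists_general (hf : Continuous f) (hA : ∀ s : ℝ, s ≤ 0 → |f s| ≤ A)
    (hfi : IntegrableOn f (Iic 0)) (hg : Continuous g) (hCg : ∀ s : ℝ, s ≤ 0 → |g s| ≤ Cg)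
    (hgi : IntegrableOn g (Iic 0))
    (hτ : (∫ t in Iic (0 : ℝ), (∑' m : ℕ, (∏ i ∈ Finset.range m, ((-4 : ℝ) / (2 ^ (i + 1) - 1))) *
        Real.exp ((2 ^ m - 1) * t)) * g t) ≠ 0) :
    ∃ σ : ℝ, ∃ h : ℝ → ℝ,
      σ = (∫ t in Iic (0 : ℝ), (∑' m : ℕ, (∏ i ∈ Finset.range m, ((-4 : ℝ) / (2 ^ (i + 1) - 1))) *
              Real.exp ((2 ^ m - 1) * t)) * f t) /
          (∫ t in Iic (0 : ℝ), (∑' m : ℕ, (∏ i ∈ Finset.range m, ((-4 : ℝ) / (2 ^ (i + 1) - 1))) *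
              Real.exp ((2 ^ m - 1) * t)) * g t) ∧
      Continuous h ∧ h 0 = 0 ∧
      (∀ t : ℝ, t < 0 → HasDerivAt h (2 * Real.exp (t / 2) * h (t / 2) + (f t - σ * g t)) t) ∧
      (∃ B : ℝ, ∀ t : ℝ, t ≤ 0 → |h t| ≤ B) ∧ Tendsto h atBot (𝓝 0) := by
  set W : ℝ → ℝ := fun t : ℝ => ∑' m : ℕ,
      (∏ i ∈ Finset.range m, ((-4 : ℝ) / (2 ^ (i + 1) - 1))) * Real.exp ((2 ^ m - 1) * t) with hW
  set τ : ℝ := ∫ t in Iic (0 : ℝ), W t * g t with hτdef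
  have hτ0 : τ ≠ 0 := hτ
  set σ : ℝ := (∫ t in Iic (0 : ℝ), W t * f t) / τ with hσ
  set fs : ℝ → ℝ := fun t => f t - σ * g t with hfs
  have hfs_cont : Continuous fs := hf.sub (continuous_const.mul hg)
  have hfs_bd : ∀ s : ℝ, s ≤ 0 → |fs s| ≤ A + |σ| * Cg := by
    intro s hs
    simp only [hfs]
    calc |f s - σ * g s| ≤ |f s| + |σ * g s| := abs_sub _ _
      _ = |f s| + |σ| * |g s| := by rw [abs_mul]
      _ ≤ A + |σ| * Cg := add_le_add (hA s hs) (mul_le_mul_of_nonneg_left (hCg s hs) (abs_nonneg _))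
  have hfs_int : IntegrableOn fs (Iic 0) := hfi.sub (hgi.const_mul σ)
  obtain ⟨h, hc, h0, hde, ⟨B, hB⟩, hlim⟩ := pantograph_inhom_exists_bounded hfs_cont hfs_bd hfs_int
  have hWcont : ContinuousOn W (Iic 0) := adjoint_continuousOn
  have hWae : ∀ᵐ t ∂(volume.restrict (Iic (0 : ℝ))), ‖W t‖ ≤ 71 :=
    (ae_restrict_iff' measurableSet_Iic).2 (Eventually.of_forall fun t ht => by
      rw [Real.norm_eq_abs]; exact adjoint_abs_le ht)
  have hI1 : IntegrableOn (fun t : ℝ => W t * f t) (Iic 0) :=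
    Integrable.bdd_mul (c := 71) hfi (hWcont.aestronglyMeasurable measurableSet_Iic) hWae
  have hI2 : IntegrableOn (fun t : ℝ => W t * g t) (Iic 0) :=
    Integrable.bdd_mul (c := 71) hgi (hWcont.aestronglyMeasurable measurableSet_Iic) hWae
  have hsplit : ∫ t in Iic (0 : ℝ), W t * fs t = (∫ t in Iic (0 : ℝ), W t * f t) - σ * τ := by
    have hfun : (fun t : ℝ => W t * fs t) = fun t : ℝ => W t * f t - σ * (W t * g t) := by
      funext t; simp only [hfs]; ring
    rw [hfun, integral_sub hI1 (hI2.const_mul σ), MeasureTheory.integral_const_mul]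
  have hzero : ∫ t in Iic (0 : ℝ), W t * fs t = 0 := by
    rw [hsplit, hσ, div_mul_cancel₀ _ hτ0, sub_self]
  have hlim0 : Tendsto h atBot (𝓝 0) := by
    have := hlim
    rw [show (fun t : ℝ => (∑' m : ℕ, (∏ i ∈ Finset.range m, ((-4 : ℝ) / (2 ^ (i + 1) - 1))) *
        Real.exp ((2 ^ m - 1) * t)) * fs t) = fun t : ℝ => W t * fs t from rfl] at this
    rwa [hzero, neg_zero] at this
  exact ⟨σ, h, rfl, hc, h0, hde, ⟨B, hB⟩, hlim0⟩

/-- The derivative of a bounded solution of a generally bordered problem is integrable. [folklore] -/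
theorem bordered_deriv_integrableOn_general (hfi : IntegrableOn f (Iic 0)) (hgi : IntegrableOn g (Iic 0))
    {σ : ℝ} {h : ℝ → ℝ} (hcont : ContinuousOn h (Iic 0)) {B : ℝ} (hB : ∀ t : ℝ, t ≤ 0 → |h t| ≤ B) :
    IntegrableOn (fun t : ℝ => 2 * Real.exp (t / 2) * h (t / 2) + (f t - σ * g t)) (Iic 0) := by
  have h1 := bordered_deriv_integrableOn (σ := 0) hfi hcont hB
  have h1' : IntegrableOn (fun t : ℝ => 2 * Real.exp (t / 2) * h (t / 2) + f t) (Iic 0) := by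
    refine h1.congr_fun (fun t _ => ?_) measurableSet_Iic
    ring
  have h2 : IntegrableOn (fun t : ℝ => 2 * Real.exp (t / 2) * h (t / 2) + f t - σ * g t) (Iic 0) :=
    h1'.sub (hgi.const_mul σ)
  refine h2.congr_fun (fun t _ => ?_) measurableSet_Iic
  ring

/-- **UNIQUENESS, general bordering direction** (`g` integrable on `(−∞,0]` with `∫w₁g ≠ 0`).
[cite: Tao2016AveragedNS, §1.2 (dyadic model); cell vocabulary (bordered linearisation at the relay profile; programme R-lac)] -/
theorem bordered_unique_general (hgi : IntegrableOn g (Iic 0))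
    (hτ : (∫ t in Iic (0 : ℝ), (∑' m : ℕ, (∏ i ∈ Finset.range m, ((-4 : ℝ) / (2 ^ (i + 1) - 1))) *
        Real.exp ((2 ^ m - 1) * t)) * g t) ≠ 0) {σ₁ σ₂ : ℝ}
    {h₁ h₂ : ℝ → ℝ} (hc₁ : ContinuousOn h₁ (Iic 0)) (hc₂ : ContinuousOn h₂ (Iic 0))
    (hd₁ : ∀ t : ℝ, t < 0 → HasDerivAt h₁ (2 * Real.exp (t / 2) * h₁ (t / 2) + (f t - σ₁ * g t)) t)
    (hd₂ : ∀ t : ℝ, t < 0 → HasDerivAt h₂ (2 * Real.exp (t / 2) * h₂ (t / 2) + (f t - σ₂ * g t)) t)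
    {B₁ B₂ : ℝ} (hB₁ : ∀ t : ℝ, t ≤ 0 → |h₁ t| ≤ B₁) (hB₂ : ∀ t : ℝ, t ≤ 0 → |h₂ t| ≤ B₂)
    (h0₁ : h₁ 0 = 0) (h0₂ : h₂ 0 = 0)
    (hl₁ : Tendsto h₁ atBot (𝓝 0)) (hl₂ : Tendsto h₂ atBot (𝓝 0)) :
    σ₁ = σ₂ ∧ ∀ t : ℝ, t ≤ 0 → h₁ t = h₂ t := by
  set W : ℝ → ℝ := fun t : ℝ => ∑' m : ℕ,
      (∏ i ∈ Finset.range m, ((-4 : ℝ) / (2 ^ (i + 1) - 1))) * Real.exp ((2 ^ m - 1) * t) with hW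
  set d : ℝ → ℝ := fun t => h₁ t - h₂ t with hd_def
  have hdc : ContinuousOn d (Iic 0) := hc₁.sub hc₂
  have hdd : ∀ t : ℝ, t < 0 → HasDerivAt d
      (2 * Real.exp (t / 2) * d (t / 2) + (0 - (σ₁ - σ₂) * g t)) t := by
    intro t ht
    refine ((hd₁ t ht).sub (hd₂ t ht)).congr_deriv ?_
    simp only [hd_def]; ring
  have hdB : ∀ t : ℝ, t ≤ 0 → |d t| ≤ B₁ + B₂ := by
    intro t ht
    simp only [hd_def]
    exact (abs_sub _ _).trans (add_le_add (hB₁ t ht) (hB₂ t ht))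
  have hd0 : d 0 = 0 := by simp [hd_def, h0₁, h0₂]
  have hdl : Tendsto d atBot (𝓝 0) := by simpa using hl₁.sub hl₂
  have hint := bordered_deriv_integrableOn_general (f := fun _ => (0 : ℝ)) integrableOn_zero hgi
    (σ := σ₁ - σ₂) hdc hdB
  have hG := adjoint_green W hW hdc hdd hdB hint hdl
  rw [hd0, mul_zero, sub_zero] at hG
  have hfun : (fun t : ℝ => W t * (2 * Real.exp (t / 2) * d (t / 2) +
      (0 - (σ₁ - σ₂) * g t) - 2 * Real.exp (t / 2) * d (t / 2))) =
      fun t : ℝ => -(σ₁ - σ₂) * (W t * g t) := by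
    funext t; ring
  rw [hfun, MeasureTheory.integral_const_mul] at hG
  have hρ : σ₁ - σ₂ = 0 := by
    rcases mul_eq_zero.1 hG with h | h
    · linarith
    · exact absurd h hτ
  have hσ : σ₁ = σ₂ := by linarith
  refine ⟨hσ, ?_⟩
  have hdd' : ∀ t : ℝ, t < 0 → HasDerivAt d (2 * Real.exp (t / 2) * d (t / 2)) t := by
    intro t ht
    refine (hdd t ht).congr_deriv ?_
    rw [hρ]; ring
  intro t ht
  have := pantograph_eq_zero hdc hdd' hd0 t ht
  simp only [hd_def] at this
  linarith

/-! ## The drain-bordered problem `g = 8e^{3t}` -/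

/-- `8e^{3t}` is bounded by `8` on `t ≤ 0` and integrable on `(−∞,0]`. [folklore] -/
theorem drain_direction_admissible :
    (∀ s : ℝ, s ≤ 0 → |8 * Real.exp (3 * s)| ≤ 8) ∧
      IntegrableOn (fun t : ℝ => 8 * Real.exp (3 * t)) (Iic 0) := by
  refine ⟨fun s hs => ?_, (integrableOn_exp_mul_Iic (by norm_num : (0 : ℝ) < 3) 0).const_mul 8⟩
  rw [abs_mul, abs_of_pos (Real.exp_pos _), show |(8 : ℝ)| = 8 by norm_num]
  have : Real.exp (3 * s) ≤ 1 := Real.exp_le_one_iff.2 (by linarith)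
  linarith

/-- **DRAIN-BORDERED EXISTENCE**: for `f` continuous, bounded, integrable on `(−∞,0]` there are
`ε = (∫w₁f)/ℓ_δ·… = (∫w₁f)/(∫w₁·8e^{3t})` and `h` (continuous, bounded, `h(0)=0`, `h(−∞)=0`) with
`h' = 2e^{t/2}h(t/2) + f − ε·8e^{3t}` on `t < 0`.
[cite: Tao2016AveragedNS, §1.2 (dyadic model); cell vocabulary (drain-bordered linearisation at the relay profile; programme R-lac)] -/
theorem drain_bordered_exists (hf : Continuous f) (hA : ∀ s : ℝ, s ≤ 0 → |f s| ≤ A)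
    (hfi : IntegrableOn f (Iic 0)) :
    ∃ ε : ℝ, ∃ h : ℝ → ℝ,
      ε = (∫ t in Iic (0 : ℝ), (∑' m : ℕ, (∏ i ∈ Finset.range m, ((-4 : ℝ) / (2 ^ (i + 1) - 1))) *
              Real.exp ((2 ^ m - 1) * t)) * f t) /
          (∫ t in Iic (0 : ℝ), (∑' m : ℕ, (∏ i ∈ Finset.range m, ((-4 : ℝ) / (2 ^ (i + 1) - 1))) *
              Real.exp ((2 ^ m - 1) * t)) * (8 * Real.exp (3 * t))) ∧
      Continuous h ∧ h 0 = 0 ∧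
      (∀ t : ℝ, t < 0 → HasDerivAt h
        (2 * Real.exp (t / 2) * h (t / 2) + (f t - ε * (8 * Real.exp (3 * t)))) t) ∧
      (∃ B : ℝ, ∀ t : ℝ, t ≤ 0 → |h t| ≤ B) ∧ Tendsto h atBot (𝓝 0) :=
  bordered_exists_general hf hA hfi (by fun_prop) drain_direction_admissible.1
    drain_direction_admissible.2 drain_functional_integral_neg.ne

/-- **DRAIN-BORDERED UNIQUENESS.** [folklore] -/
theorem drain_bordered_unique {σ₁ σ₂ : ℝ}
    {h₁ h₂ : ℝ → ℝ} (hc₁ : ContinuousOn h₁ (Iic 0)) (hc₂ : ContinuousOn h₂ (Iic 0))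
    (hd₁ : ∀ t : ℝ, t < 0 → HasDerivAt h₁
      (2 * Real.exp (t / 2) * h₁ (t / 2) + (f t - σ₁ * (8 * Real.exp (3 * t)))) t)
    (hd₂ : ∀ t : ℝ, t < 0 → HasDerivAt h₂
      (2 * Real.exp (t / 2) * h₂ (t / 2) + (f t - σ₂ * (8 * Real.exp (3 * t)))) t)
    {B₁ B₂ : ℝ} (hB₁ : ∀ t : ℝ, t ≤ 0 → |h₁ t| ≤ B₁) (hB₂ : ∀ t : ℝ, t ≤ 0 → |h₂ t| ≤ B₂)
    (h0₁ : h₁ 0 = 0) (h0₂ : h₂ 0 = 0)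
    (hl₁ : Tendsto h₁ atBot (𝓝 0)) (hl₂ : Tendsto h₂ atBot (𝓝 0)) :
    σ₁ = σ₂ ∧ ∀ t : ℝ, t ≤ 0 → h₁ t = h₂ t :=
  bordered_unique_general drain_direction_admissible.2 drain_functional_integral_neg.ne
    hc₁ hc₂ hd₁ hd₂ hB₁ hB₂ h0₁ h0₂ hl₁ hl₂

end WakeRatchetRelayBorderedGeneral

end Summit.NavierStokesRegularity.NavierStokesRegularity.Theorems

end
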